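import Summits.CriticalPhenomena.PercolationContinuityZ3.Theorems.Transplant.KNCells2AnchorDepth
import HarnessLib

/-!
# Lag-1 anchored cells, unit-increment anchors: ANCHORS DOMINATE THE PLANAR ℓ¹-POSITION — every occupied macro-vertex `v` has
# `‖v‖₁ ≤ dep v` and `‖v‖₁ ≤ arr v + 1`; the cell examined along a chosen edge `e` has `‖tgt e‖₁ ≤ aOf₁ + 2` and `≤ aOf₂ + 1`
# (the fact the generic (D) schedule over a planar skeleton needs to see that its position-inflated cube radii are inactive at every RUN pair —
# SHEAR-SCOPE §3.9 L3.3, stmt-g7 18:38:47Z (b), p3-g4 18:39:38Z (B))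

builds on p205010 (kernel theorem, internal audit signed; external expert review pending) — nothing in this file uses p205010.
Lane `prim-bschramm-*`, seat `prim-bschramm-p2` (gen 3); helper file (`--supports stmt-CriticalPhenomena-4575`).  Generic over the vertex
type `V` and any `S : KSchA V ℕ` with the unit-increment re-centring rule `anchor a v P = a + 1`, `a₀ = 0` (design (D)).

* `l1 v := |v 0| + |v 1|`, `l1_zero`, `l1_tgt_le` (`‖tgt e‖₁ ≤ ‖e.1‖₁ + 1`);
* **`norm_le_anchors`** — replay invariant: after any history, every macro-vertex either still carries the root anchors `(0, 0)` and is occupied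
  only if it is the root, or satisfies `‖v‖₁ ≤ dep v ∧ ‖v‖₁ ≤ arr v + 1`;
* `norm_le_dep_of_occ`, `norm_le_arr_succ_of_occ` (occupied vertices);
* **`norm_tgt_le_aOf₁_add_two`, `norm_tgt_le_aOf₂_succ`, `norm_src_le_aOf₁_succ`** (at a chosen edge of the replayed macro-state).
[cite: KozmaNitzan2024, §4 pp. 25–27 (the exploration process; E_{i+1})]
-/

noncomputable section

open scoped Classical

namespace Summit.CriticalPhenomena.PercolationContinuityZ3.Theorems

namespace Transplant

namespace KNCells

open Literature.Probability.Percolation Literature.Probability.LatticeModels SimpleGraph GadgetSystem ProbeHistory HSiteScheme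
open Literature.Probability.Percolation.KozmaNitzan.Cells (oth oth_ne sgOf sgOf_sign stepVec_apply_fst stepVec_apply_oth eq_oth_of_ne oth_oth)

/-- The planar ℓ¹-norm of a macro-vertex. [folklore] -/
def l1 (v : Site 2) : ℕ := (v 0).natAbs + (v 1).natAbs

/-- `‖0‖₁ = 0`. [folklore] -/
@[simp] theorem l1_zero : l1 0 = 0 := by simp [l1]

/-- A macro-step changes the ℓ¹-norm by at most one: `‖tgt e‖₁ ≤ ‖e.1‖₁ + 1`. [folklore] -/
theorem l1_tgt_le (e : Site 2 × MDir) : l1 (tgt e) ≤ l1 e.1 + 1 := by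
  unfold l1 tgt
  have h1 : stepVec e.2 e.2.1 = sgOf e.2 := stepVec_apply_fst e.2
  have h2 : stepVec e.2 (oth e.2.1) = 0 := stepVec_apply_oth e.2
  have hs : sgOf e.2 = 1 ∨ sgOf e.2 = -1 := sgOf_sign e.2
  have hd : e.2.1 = 0 ∨ e.2.1 = 1 := by
    rcases e.2 with ⟨i, b⟩
    fin_cases i <;> simp
  rcases hd with hd | hd
  · have ho : oth e.2.1 = 1 := by rw [hd]; rfl
    rw [hd] at h1; rw [ho] at h2
    simp only [Pi.add_apply, h1, h2, add_zero]
    rcases hs with hs | hs <;> rw [hs] <;> omega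
  · have ho : oth e.2.1 = 0 := by rw [hd]; rfl
    rw [hd] at h1; rw [ho] at h2
    simp only [Pi.add_apply, h1, h2, add_zero]
    rcases hs with hs | hs <;> rw [hs] <;> omega

namespace KSchA

variable {V : Type*} [DecidableEq V] {G : SimpleGraph V} [G.LocallyFinite] {S : KSchA V ℕ}

/-- **Replay invariant: anchors dominate the planar position** (unit-increment rule, root anchor `0`): after any history every macro-vertex `v`
either carries the anchors `(0, 0)` and is occupied only if `v = 0`, or satisfies `‖v‖₁ ≤ dep v` and `‖v‖₁ ≤ arr v + 1` (a target examined
from an occupied source `u` gets `arr := dep u ≥ ‖u‖₁ ≥ ‖v‖₁ − 1` and `dep := dep u + 1`). [folklore] -/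
theorem norm_le_anchors (hanch : ∀ a v P, S.Γ.anchor a v P = a + 1) (h0 : S.Γ.a₀ = 0) :
    ∀ (h : ProbeHistory V) (v : Site 2),
      ((S.astOf₂ G h).arr v = 0 ∧ (S.astOf₂ G h).dep v = 0 ∧ (v ∈ (S.astOf₂ G h).st.occ → v = 0)) ∨
        (l1 v ≤ (S.astOf₂ G h).dep v ∧ l1 v ≤ (S.astOf₂ G h).arr v + 1)
  | [], v => by
    left
    refine ⟨by simp [astOf₂_nil, h0], by simp [astOf₂_nil, h0], fun hv => ?_⟩
    simpa [astOf₂_nil, HState.start] using hv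
  | none :: h, v => by
    rw [astOf₂_cons_none]; exact norm_le_anchors hanch h0 h v
  | some r :: h, v => by
    rw [astOf₂_cons_some]
    cases hc : (S.astOf₂ G h).st.choice with
    | none => exact norm_le_anchors hanch h0 h v
    | some e =>
      dsimp only
      by_cases hve : v = tgt e
      · subst hve
        right
        simp only [Function.update_self, depB, hanch]
        -- the source is occupied; apply the invariant to it
        have hocc : e.1 ∈ (S.astOf₂ G h).st.occ := (HState.cand_of_choice hc).1
        have hstep := l1_tgt_le e
        rcases norm_le_anchors hanch h0 h e.1 with ⟨h1, h2, h3⟩ | ⟨h1, h2⟩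
        · have he0 : e.1 = 0 := h3 hocc
          rw [he0, l1_zero] at hstep
          rw [h2]; omega
        · omega
      · rcases norm_le_anchors hanch h0 h v with ⟨h1, h2, h3⟩ | ⟨h1, h2⟩
        · left
          refine ⟨by rw [Function.update_of_ne hve]; exact h1, by rw [Function.update_of_ne hve]; exact h2, fun hocc => ?_⟩
          rcases Finset.mem_insert.1 (HState.occ_update_subset _ _ _ hocc) with h' | h'
          · exact absurd h' hve
          · exact h3 h'
        · right
          exact ⟨by rw [Function.update_of_ne hve]; exact h1, by rw [Function.update_of_ne hve]; exact h2⟩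

/-- An occupied macro-vertex satisfies `‖v‖₁ ≤ dep v`. [folklore] -/
theorem norm_le_dep_of_occ (hanch : ∀ a v P, S.Γ.anchor a v P = a + 1) (h0 : S.Γ.a₀ = 0) (h : ProbeHistory V) {v : Site 2}
    (hv : v ∈ (S.astOf₂ G h).st.occ) : l1 v ≤ (S.astOf₂ G h).dep v := by
  rcases norm_le_anchors (S := S) (G := G) hanch h0 h v with ⟨-, -, h3⟩ | ⟨h1, -⟩
  · rw [h3 hv, l1_zero]; exact Nat.zero_le _
  · exact h1

/-- An occupied macro-vertex satisfies `‖v‖₁ ≤ arr v + 1`. [folklore] -/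
theorem norm_le_arr_succ_of_occ (hanch : ∀ a v P, S.Γ.anchor a v P = a + 1) (h0 : S.Γ.a₀ = 0) (h : ProbeHistory V) {v : Site 2}
    (hv : v ∈ (S.astOf₂ G h).st.occ) : l1 v ≤ (S.astOf₂ G h).arr v + 1 := by
  rcases norm_le_anchors (S := S) (G := G) hanch h0 h v with ⟨-, -, h3⟩ | ⟨-, h2⟩
  · rw [h3 hv, l1_zero]; exact Nat.zero_le _
  · exact h2

/-- **At a chosen edge the examined cell lies within `aOf₁ + 2` of the macro-origin**: `‖tgt e‖₁ ≤ α + 2` (`α = arr e.1`, the arrival anchor of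
the occupied source). [folklore] -/
theorem norm_tgt_le_aOf₁_add_two (hanch : ∀ a v P, S.Γ.anchor a v P = a + 1) (h0 : S.Γ.a₀ = 0) (h : ProbeHistory V)
    {e : Site 2 × MDir} (hc : (S.astOf₂ G h).st.choice = some e) : l1 (tgt e) ≤ S.aOf₁ G h e + 2 := by
  have := norm_le_arr_succ_of_occ (S := S) (G := G) hanch h0 h (HState.cand_of_choice hc).1
  have := l1_tgt_le e
  change l1 (tgt e) ≤ (S.astOf₂ G h).arr e.1 + 2
  omega

/-- **… and within `aOf₂ + 1`**: `‖tgt e‖₁ ≤ β + 1` (`β = dep e.1`, the stub anchor). [folklore] -/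
theorem norm_tgt_le_aOf₂_succ (hanch : ∀ a v P, S.Γ.anchor a v P = a + 1) (h0 : S.Γ.a₀ = 0) (h : ProbeHistory V)
    {e : Site 2 × MDir} (hc : (S.astOf₂ G h).st.choice = some e) : l1 (tgt e) ≤ S.aOf₂ G h e + 1 := by
  have := norm_le_dep_of_occ (S := S) (G := G) hanch h0 h (HState.cand_of_choice hc).1
  have := l1_tgt_le e
  change l1 (tgt e) ≤ (S.astOf₂ G h).dep e.1 + 1
  omega

/-- The source of a chosen edge satisfies `‖e.1‖₁ ≤ aOf₁ + 1`. [folklore] -/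
theorem norm_src_le_aOf₁_succ (hanch : ∀ a v P, S.Γ.anchor a v P = a + 1) (h0 : S.Γ.a₀ = 0) (h : ProbeHistory V)
    {e : Site 2 × MDir} (hc : (S.astOf₂ G h).st.choice = some e) : l1 e.1 ≤ S.aOf₁ G h e + 1 :=
  norm_le_arr_succ_of_occ hanch h0 h (HState.cand_of_choice hc).1

end KSchA

end KNCells

end Transplant

end Summit.CriticalPhenomena.PercolationContinuityZ3.Theorems

end
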